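import Literature.Probability.Percolation.UniqueClusterDensityBound
import Literature.Probability.Percolation.UniquenessInsertionTolerant
import HarnessLib

/-!
# No three infinite branches: the unique infinite cluster of an invariant insertion-tolerant law has at most two ends

Topic `Literature/Probability/Percolation`; theorems only. For a probability measure `μ` on bond
configurations of `ℤ^d` (`d ≥ 1`) which is carried by nearest-neighbour configurations, invariant
under lattice translations and box insertion tolerant (the three hypotheses actually used by the
cut-ball counting of Bollobás–Riordan, *Percolation* (2006), Ch. 5, Thm. 4, as isolated in the
tree's `measure_threeInfClusters_eq_zero_of_invariant`, `UniqueClusterDensityBound.lean`), we prove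

* `measureReal_cutBall_eq_zero_of_invariant` — **every cut-ball event is null**: `μ(T_r(0)) = 0`
  for all `r` (the counting argument of Bollobás–Riordan 2006, Ch. 5, pp. 107–109, verbatim from the
  tree: `a = μ(T_r(0)) > 0` would give `≥ a(2m+1)^d` expected cut-balls among `(2m+1)^d` disjoint
  translates inside `Λ_n`, against the deterministic bound `|∂ⁱⁿΛ_{n+1}| = O((2m+1)^{d-1})`);
* `threeBranches` — the event "**some finite set of vertices has three infinite branches**": there
  are a finite `K ⊆ V` and three vertices lying in three distinct infinite open clusters of `ω - K`
  (open paths avoiding `K`). For the (a.s. unique) infinite cluster this says exactly that it has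
  **at least three ends** in the sense of Halin / Freudenthal used by
  Raoufi, *Ann. Probab.* 48 (2020), §2 before Thm. 3 ("an infinite graph has `k` ends if the
  maximum, over all finite `V' ⊂ V`, of the number of infinite connected components of the induced
  subgraph of `V ∖ V'` is equal to `k`"); `threeInfClusters ⊆ threeBranches` (`K = ∅`);
* `isCutSet_openEdges_of_threeBranches` — **three branches make a cut-ball**: if `K` and the three
  witnesses lie in the finite set `B`, then opening all edges of `B` turns `B` into a cut set
  (`IsCutSet`, the tree's bond version of Bollobás–Riordan's `T_r(x)`); this is the observation
  "opening `B_r(x₀)` gives `T_r(x₀)`" of Bollobás–Riordan 2006, p. 107, with "three infinite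
  clusters meeting the ball" replaced by "three infinite branches of `ω - K` starting in the ball",
  via the tree's exit-point lemma `exists_branch_of_percolatesAt`;
* `measure_threeBranches_eq_zero_of_invariant` — hence **`μ(threeBranches) = 0`**: this is the
  "at most two ends" half of Raoufi 2020, Thm. 3 ("if the infinite cluster exists, then its number of
  ends is at most 2 … proved using a Burton–Keane type argument"), for every translation-invariant,
  box-insertion-tolerant, lattice-supported `μ` on `ℤ^d` — no ergodicity and no uniqueness of the
  infinite cluster are needed for this half (Burton–Keane, CMP 121 (1989), Thm. 2 prove "one end"
  under finite energy; the two-ends bound is what the counting gives without deletion tolerance).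

## References

* B. Bollobás, O. Riordan, *Percolation*, CUP 2006, Ch. 5, proof of Thm. 4, pp. 107–109
  [BollobasRiordan2006].
* R. M. Burton, M. Keane, *Density and uniqueness in percolation*, Comm. Math. Phys. 121 (1989)
  501–505, Thm. 2 [BurtonKeane1989].
* A. Raoufi, *Translation-invariant Gibbs states of the Ising model: general setting*, Ann. Probab.
  48 (2020) 760–777 (arXiv:1710.07608), §2, Thm. 3 [Raoufi2020].

## Mathlib status

No percolation in Mathlib. Anchors: `SimpleGraph.Reachable`, `MeasureTheory.measure_iUnion_null_iff`;
tree: `IsCutSet`, `cutBall`, `exists_branch_of_percolatesAt`, `openClusterIn_openEdges_of_disjoint`,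
`real_cutBall_zero_le_of_invariant`, `sum_measure_cutBall_le_of_ae_subset`, `card_centres`,
`card_innerBoundary_box_le` (`UniquenessInfiniteCluster.lean`, `UniqueClusterDensityBound.lean`,
`SiteConnectionTools.lean`), `openConnVia`, `percolatesVia`, `withinGraph` (`ConstrainedClusters.lean`).
-/

noncomputable section

namespace Literature.Probability.Percolation

open MeasureTheory SimpleGraph Finset
open Percolation (shiftedBox mem_shiftedBox_iff shiftedBox_zero)
open scoped ENNReal

variable {V : Type*}

/-! ### The event "three infinite branches" -/

section Event

variable (V)

/-- The event **"some finite vertex set has three infinite branches"**: there are a finite set `K`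
and three vertices lying in pairwise distinct infinite open clusters of `ω - K` (open paths all of
whose steps avoid `K`, the step graph `withinGraph ⊤ Kᶜ` of `ConstrainedClusters.lean`). When the
infinite open cluster is unique this is the event that it has at least three ends (Raoufi 2020, §2:
"`k` ends if the maximum, over all finite `V' ⊂ V`, of the number of infinite connected components of
the induced subgraph of `V ∖ V'` is equal to `k`"). [cite: Raoufi2020, §2, before Thm. 3] -/
def threeBranches : Set (BondConfig V) :=
  {ω | ∃ (K : Finset V) (w : Fin 3 → V),
    (∀ i j, ω ∈ openConnVia (withinGraph ⊤ (↑K : Set V)ᶜ) (w i) (w j) → i = j) ∧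
    (∀ i, ω ∈ percolatesVia (withinGraph ⊤ (↑K : Set V)ᶜ) (w i))}

variable {V}

/-- Membership in `threeBranches`, unfolded. [cite: Raoufi2020, §2, before Thm. 3] -/
theorem mem_threeBranches_iff (ω : BondConfig V) :
    ω ∈ threeBranches V ↔ ∃ (K : Finset V) (w : Fin 3 → V),
      (∀ i j, ω ∈ openConnVia (withinGraph ⊤ (↑K : Set V)ᶜ) (w i) (w j) → i = j) ∧
      (∀ i, ω ∈ percolatesVia (withinGraph ⊤ (↑K : Set V)ᶜ) (w i)) :=
  Iff.rfl

/-- With `K = ∅` the constraint is void: the unconstrained cluster is the cluster constrained to the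
steps of `withinGraph ⊤ univ = ⊤`. [folklore] -/
theorem openClusterIn_withinGraph_top_compl_empty (ω : BondConfig V) (x : V) :
    openClusterIn (withinGraph ⊤ ((↑(∅ : Finset V) : Set V)ᶜ)) ω x = openCluster ω x := by
  ext y
  rw [mem_openClusterIn_withinGraph_top_iff]
  change _ ↔ (openGraph ω).Reachable x y
  have h : withinGraph (openGraph ω) ((↑(∅ : Finset V) : Set V)ᶜ) = openGraph ω := by
    ext a b
    simp [withinGraph_adj]
  rw [h]

/-- **Three infinite clusters are three branches** (of `K = ∅`). [folklore] -/
theorem threeInfClusters_subset_threeBranches : threeInfClusters V ⊆ threeBranches V := by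
  rintro ω ⟨x, y, z, hx, hy, hz, hxy, hxz, hyz⟩
  refine ⟨∅, ![x, y, z], fun i j hij => ?_, fun i => ?_⟩
  · change (![x, y, z]) j ∈ openClusterIn _ ω ((![x, y, z]) i) at hij
    rw [openClusterIn_withinGraph_top_compl_empty] at hij
    change (openGraph ω).Reachable _ _ at hij
    fin_cases i <;> fin_cases j <;> simp at hij ⊢
    all_goals first
      | exact hxy hij | exact hxy hij.symm | exact hxz hij | exact hxz hij.symm | exact hyz hij
      | exact hyz hij.symm
  · change (openClusterIn _ ω ((![x, y, z]) i)).Infinite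
    rw [openClusterIn_withinGraph_top_compl_empty]
    fin_cases i
    · exact hx
    · exact hy
    · exact hz

/-- A cut set has three branches. [folklore] -/
theorem IsCutSet.mem_threeBranches [DecidableEq V] {G : SimpleGraph V} [G.LocallyFinite]
    {K : Finset V} {ω : BondConfig V} (h : IsCutSet G K ω) : ω ∈ threeBranches V := by
  obtain ⟨w, -, -, hdis, hperc⟩ := h.branches
  exact ⟨K, w, hdis, hperc⟩

/-- The witnesses of three branches of `ω - K` lie outside `K` (a vertex of `K` has no step avoiding
`K`, so its constrained cluster is a singleton). [folklore] -/
theorem notMem_of_percolatesVia_compl {K : Finset V} {ω : BondConfig V} {x : V}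
    (hx : ω ∈ percolatesVia (withinGraph ⊤ (↑K : Set V)ᶜ) x) : x ∉ K := by
  intro hxK
  refine hx ?_
  have hsub : openClusterIn (withinGraph ⊤ (↑K : Set V)ᶜ) ω x ⊆ {x} := by
    intro y hy
    rw [mem_openClusterIn_withinGraph_top_iff] at hy
    obtain ⟨p⟩ := hy
    cases p with
    | nil => rfl
    | cons h _ => exact absurd hxK h.2.1
  exact (Set.finite_singleton x).subset hsub

/-- `threeBranches` is measurable (`V` countable): a countable union over `K` and the witnesses of
finite Boolean combinations of the measurable events `openConnVia`, `percolatesVia`. [folklore] -/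
theorem measurableSet_threeBranches [Countable V] : MeasurableSet (threeBranches V) := by
  classical
  have heq : threeBranches V = ⋃ K : Finset V, ⋃ w : Fin 3 → V,
      ((⋂ i, ⋂ j, {_ω | i = j} ∪ (openConnVia (withinGraph ⊤ (↑K : Set V)ᶜ) (w i) (w j))ᶜ) ∩
        (⋂ i, percolatesVia (withinGraph ⊤ (↑K : Set V)ᶜ) (w i))) := by
    ext ω
    simp only [threeBranches, Set.mem_setOf_eq, Set.mem_iUnion, Set.mem_inter_iff, Set.mem_iInter,
      Set.mem_union, Set.mem_compl_iff]
    constructor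
    · rintro ⟨K, w, hdis, hperc⟩
      refine ⟨K, w, fun i j => ?_, hperc⟩
      by_cases hij : i = j
      · exact Or.inl hij
      · exact Or.inr fun h => hij (hdis i j h)
    · rintro ⟨K, w, hdis, hperc⟩
      refine ⟨K, w, fun i j h => ?_, hperc⟩
      rcases hdis i j with hij | hij
      · exact hij
      · exact absurd h hij
  rw [heq]
  haveI : Countable (Finset V) := inferInstance
  exact MeasurableSet.iUnion fun K => MeasurableSet.iUnion fun w =>
    (MeasurableSet.iInter fun i => MeasurableSet.iInter fun j => (MeasurableSet.const _).union
      (measurableSet_openConnVia _ (w i) (w j)).compl).inter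
    (MeasurableSet.iInter fun i => measurableSet_percolatesVia _ (w i))

end Event

/-! ### Three branches starting in a ball make the opened ball a cut-ball -/

section CutBall

/-- The steps avoiding a larger set avoid a smaller set. [folklore] -/
theorem edgeSet_withinGraph_top_compl_mono {K B : Set V} (h : K ⊆ B) :
    (withinGraph (⊤ : SimpleGraph V) Bᶜ).edgeSet ⊆ (withinGraph (⊤ : SimpleGraph V) Kᶜ).edgeSet :=
  SimpleGraph.edgeSet_mono (withinGraph_mono ⊤ (Set.compl_subset_compl.2 h))

/-- **Three branches make a cut set** (the mechanism of Bollobás–Riordan 2006, Ch. 5, p. 107, "if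
`B_r(x₀)` meets three infinite open clusters … changing the states of all the sites in `B_r(x₀)` to
open [gives] `T_r(x₀)`", applied to the branches of `ω - K` instead of whole clusters): if `ω ⊆ E(G)`,
the three vertices `w i` lie in distinct infinite open clusters of `ω - K`, and the finite set `B`
contains `K` and the `w i`, then `B` is a cut set of `ω ∪ E(B)`. Each infinite branch of `w i` in
`ω - K`, being an infinite cluster of the restricted configuration `ω ∩ E(ω - K)` meeting `B`, leaves
`B` through a last exit edge into an infinite cluster of `ω - B` (`exists_branch_of_percolatesAt`); the
three exits are pairwise disconnected in `ω - B ⊆ ω - K`, and opening `E(B)` does not change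
`ω - B`. [cite: BollobasRiordan2006, Ch. 5, proof of Thm. 4 (p. 107)] -/
theorem isCutSet_openEdges_of_threeBranches [DecidableEq V] {G : SimpleGraph V} [G.LocallyFinite]
    {K B : Finset V} {ω : BondConfig V} (hωG : ω ⊆ G.edgeSet) {w : Fin 3 → V}
    (hdis : ∀ i j, ω ∈ openConnVia (withinGraph ⊤ (↑K : Set V)ᶜ) (w i) (w j) → i = j)
    (hperc : ∀ i, ω ∈ percolatesVia (withinGraph ⊤ (↑K : Set V)ᶜ) (w i))
    (hKB : K ⊆ B) (hwB : ∀ i, w i ∈ B) :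
    IsCutSet G B (openEdges ↑(LatticeModels.edgesIn G B) ω) := by
  -- the configuration with the steps touching `K` removed
  set ω₀ : BondConfig V := ω ∩ (withinGraph ⊤ (↑K : Set V)ᶜ).edgeSet with hω₀
  have hω₀ω : ω₀ ⊆ ω := Set.inter_subset_left
  have hω₀G : ω₀ ⊆ G.edgeSet := hω₀ω.trans hωG
  have hperc₀ : ∀ i, ω₀ ∈ percolatesAt (w i) := fun i => by
    have h := hperc i
    rwa [percolatesVia_eq_preimage] at h
  -- the exit points of the three branches from `B`
  choose a haB haadj hwa haperc using
    fun i => exists_branch_of_percolatesAt B hω₀G (hwB i) (hperc₀ i)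
  have hcut : ∀ x, openClusterIn (withinGraph ⊤ (↑B : Set V)ᶜ) (openEdges ↑(LatticeModels.edgesIn G B) ω) x =
      openClusterIn (withinGraph ⊤ (↑B : Set V)ᶜ) ω x :=
    openClusterIn_openEdges_of_disjoint (disjoint_edgesIn_edgeSet_withinGraph_compl B) ω
  -- `ω - B` is a sub-configuration of `ω - K`
  have hBK : ω ∩ (withinGraph ⊤ (↑B : Set V)ᶜ).edgeSet ⊆ ω₀ :=
    Set.inter_subset_inter_right _ (edgeSet_withinGraph_top_compl_mono (Finset.coe_subset.2 hKB))
  refine ⟨subset_openEdges_right _ _, a, haB, fun i => ?_, fun i j hij => ?_, fun i => ?_⟩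
  · obtain ⟨k, hk, hadj⟩ := haadj i
    exact ⟨k, hk, fromEdgeSet_mono (hω₀ω.trans (subset_openEdges _ ω)) hadj⟩
  · change a j ∈ openClusterIn _ _ (a i) at hij
    rw [hcut] at hij
    -- `a i ↔ a j` in `ω - B`, hence in `ω₀`; and `w i ↔ a i`, `w j ↔ a j` in `ω₀`
    have hij₀ : (openGraph ω₀).Reachable (a i) (a j) := openCluster_mono hBK (a i) hij
    have hw : (openGraph ω₀).Reachable (w i) (w j) := ((hwa i).trans hij₀).trans (hwa j).symm
    exact hdis i j hw
  · change (openClusterIn _ _ (a i)).Infinite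
    rw [hcut]
    exact (haperc i).mono (openCluster_mono (Set.inter_subset_inter_left _ hω₀ω) (a i))

variable {d : ℕ}

/-- On `ℤ^d`: if `K` and the three witnesses of three branches of `ω - K` lie in the box `Λ_r`
(`ω` a lattice configuration), then opening `Λ_r` produces the cut-ball event `T_r(0)`. [cite: BollobasRiordan2006, Ch. 5, proof of Thm. 4 (p. 107)] -/
theorem openEdges_mem_cutBall_of_threeBranches {K : Finset (LatticeModels.Site d)} {r : ℕ}
    {ω : BondConfig (LatticeModels.Site d)} (hωG : ω ⊆ (LatticeModels.zdGraph d).edgeSet)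
    {w : Fin 3 → LatticeModels.Site d}
    (hdis : ∀ i j, ω ∈ openConnVia (withinGraph ⊤ (↑K : Set (LatticeModels.Site d))ᶜ) (w i) (w j) → i = j)
    (hperc : ∀ i, ω ∈ percolatesVia (withinGraph ⊤ (↑K : Set (LatticeModels.Site d))ᶜ) (w i))
    (hK : K ⊆ LatticeModels.box d r) (hw : ∀ i, w i ∈ LatticeModels.box d r) :
    openEdges ↑(LatticeModels.edgesIn (LatticeModels.zdGraph d) (LatticeModels.box d r)) ω ∈
      cutBall (0 : LatticeModels.Site d) r := by
  classical
  change IsCutSet (LatticeModels.zdGraph d) (shiftedBox 0 r) _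
  rw [shiftedBox_zero]
  exact isCutSet_openEdges_of_threeBranches hωG hdis hperc hK hw

end CutBall

/-! ### Cut-balls are null for translation-invariant lattice measures -/

section Invariant

variable {d : ℕ}

/-- **Cut-ball events are null** for a translation-invariant probability measure on bond
configurations of `ℤ^d`, `d ≥ 1`, carried by nearest-neighbour configurations (the counting of
Bollobás–Riordan 2006, Ch. 5, proof of Thm. 4, pp. 107–109, as in the tree's
`measure_threeInfClusters_eq_zero_of_invariant`, from which this is extracted): if
`a = μ(T_r(0)) > 0` then `μ(T_r(c)) ≥ a` at each of the `(2m+1)^d` centres `c ∈ (2r+2)Λ_m` (translation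
invariance), so the expected number of cut-balls among these disjoint translates of `Λ_r` inside
`Λ_n`, `n = (2r+2)m + r`, is `≥ a(2m+1)^d`; but deterministically there are at most
`|∂ⁱⁿΛ_{n+1}| ≤ 2d(2n+3)^{d-1} = O((2m+1)^{d-1})` of them — contradiction for `m` large. [cite: BollobasRiordan2006, Ch. 5, proof of Thm. 4 (pp. 107–109)] -/
theorem measureReal_cutBall_eq_zero_of_invariant (hd : 1 ≤ d)
    (μ : Measure (BondConfig (LatticeModels.Site d))) [IsProbabilityMeasure μ]
    (hS : ∀ᵐ ω ∂μ, ω ⊆ (LatticeModels.zdGraph d).edgeSet)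
    (hT : ∀ v : LatticeModels.Site d, MeasurePreserving (BondConfig.relabel (sym2Equiv (LatticeModels.Site.shift v))) μ μ)
    (r : ℕ) : μ.real (cutBall (0 : LatticeModels.Site d) r) = 0 := by
  classical
  by_contra hne
  have ha : 0 < μ.real (cutBall (0 : LatticeModels.Site d) r) :=
    lt_of_le_of_ne measureReal_nonneg (Ne.symm hne)
  set a := μ.real (cutBall (0 : LatticeModels.Site d) r) with ha_def
  -- choose the number of translates
  set C₀ : ℕ := 2 * d * (2 * r + 3) ^ (d - 1) with hC₀
  obtain ⟨m, hm⟩ := exists_nat_gt ((C₀ : ℝ) / a)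
  have hm' : (C₀ : ℝ) < a * (2 * m + 1) := by
    rw [div_lt_iff₀ ha] at hm
    nlinarith
  set n := (2 * r + 2) * m + r with hn
  set L := LatticeModels.innerBoundary (LatticeModels.zdGraph d) (LatticeModels.box d (n + 1)) with hL
  -- lower bound for the expected number of cut-balls
  have hlow : ((2 * m + 1 : ℝ)) ^ d * a ≤ ∑ c ∈ centres r m, μ.real (cutBall c r) := by
    calc ((2 * m + 1 : ℝ)) ^ d * a = ∑ _c ∈ centres (d := d) r m, a := by
          rw [Finset.sum_const, card_centres, nsmul_eq_mul]; push_cast; ring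
      _ ≤ ∑ c ∈ centres r m, μ.real (cutBall c r) :=
          Finset.sum_le_sum fun c _ => real_cutBall_zero_le_of_invariant μ hT c r
  -- upper bound
  have hup : ∑ c ∈ centres r m, μ.real (cutBall c r) ≤ (L.card : ℝ) := by
    have h := sum_measure_cutBall_le_of_ae_subset (d := d) μ hS r m
    have hsum : ∑ c ∈ centres r m, μ.real (cutBall c r) =
        (∑ c ∈ centres r m, μ (cutBall c r)).toReal := by
      rw [ENNReal.toReal_sum fun c _ => measure_ne_top _ _]
      rfl
    rw [hsum]
    have := ENNReal.toReal_mono (ENNReal.natCast_ne_top L.card) h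
    simpa using this
  -- the boundary is small
  have hLcard : (L.card : ℝ) ≤ C₀ * (2 * m + 1 : ℝ) ^ (d - 1) := by
    have h1 := card_innerBoundary_box_le (d := d) (n + 1)
    have h2 : 2 * (n + 1) + 1 ≤ (2 * r + 3) * (2 * m + 1) := by
      have : (2 * r + 3) * (2 * m + 1) = 2 * (n + 1) + 1 + 2 * m := by rw [hn]; ring
      omega
    calc (L.card : ℝ) ≤ ((2 * d * (2 * (n + 1) + 1) ^ (d - 1) : ℕ) : ℝ) := by exact_mod_cast h1
      _ ≤ ((2 * d * ((2 * r + 3) * (2 * m + 1)) ^ (d - 1) : ℕ) : ℝ) := by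
          exact_mod_cast Nat.mul_le_mul_left _ (Nat.pow_le_pow_left h2 _)
      _ = C₀ * (2 * m + 1 : ℝ) ^ (d - 1) := by rw [hC₀]; push_cast; rw [mul_pow]; ring
  -- combine
  have hpow : (2 * m + 1 : ℝ) ^ d = (2 * m + 1) * (2 * m + 1) ^ (d - 1) := by
    conv_lhs => rw [← Nat.sub_add_cancel hd, pow_succ]
    ring
  have hchain := hlow.trans (hup.trans hLcard)
  rw [hpow] at hchain
  have hpos : (0 : ℝ) < (2 * m + 1) ^ (d - 1) := by positivity
  have key : (2 * m + 1 : ℝ) * a ≤ C₀ := by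
    have h' : ((2 * m + 1 : ℝ) * a) * (2 * m + 1) ^ (d - 1) ≤ (C₀ : ℝ) * (2 * m + 1) ^ (d - 1) := by
      linarith [hchain]
    exact le_of_mul_le_mul_right h' hpos
  linarith [key, hm']

/-- The same in `ℝ≥0∞`: `μ(T_r(c)) = 0` at every centre. [cite: BollobasRiordan2006, Ch. 5, proof of Thm. 4 (pp. 107–109)] -/
theorem measure_cutBall_eq_zero_of_invariant (hd : 1 ≤ d)
    (μ : Measure (BondConfig (LatticeModels.Site d))) [IsProbabilityMeasure μ]
    (hS : ∀ᵐ ω ∂μ, ω ⊆ (LatticeModels.zdGraph d).edgeSet)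
    (hT : ∀ v : LatticeModels.Site d, MeasurePreserving (BondConfig.relabel (sym2Equiv (LatticeModels.Site.shift v))) μ μ)
    (c : LatticeModels.Site d) (r : ℕ) : μ (cutBall c r) = 0 := by
  have h0 : μ (cutBall (0 : LatticeModels.Site d) r) = 0 := by
    have h := measureReal_cutBall_eq_zero_of_invariant hd μ hS hT r
    rwa [measureReal_def, ENNReal.toReal_eq_zero_iff, or_iff_left (measure_ne_top _ _)] at h
  -- `T_r(c)` translates into `T_r(c + (-c)) = T_r(0)`
  have hsub := cutBall_subset_preimage_shift c (-c) r
  rw [add_neg_cancel] at hsub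
  have hpre : μ (BondConfig.relabel (sym2Equiv (LatticeModels.Site.shift (-c))) ⁻¹' cutBall (0 : LatticeModels.Site d) r) = 0 := by
    rw [(hT (-c)).measure_preimage (measurableSet_cutBall 0 r).nullMeasurableSet, h0]
  exact measure_mono_null hsub hpre

/-! ### Three branches are null: the infinite cluster has at most two ends -/

/-- The event "three branches with `K` and the witnesses inside `Λ_r`". [folklore] -/
def threeBranchesInBox (r : ℕ) : Set (BondConfig (LatticeModels.Site d)) :=
  {ω | ∃ (K : Finset (LatticeModels.Site d)) (w : Fin 3 → LatticeModels.Site d),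
    K ⊆ LatticeModels.box d r ∧ (∀ i, w i ∈ LatticeModels.box d r) ∧
    (∀ i j, ω ∈ openConnVia (withinGraph ⊤ (↑K : Set (LatticeModels.Site d))ᶜ) (w i) (w j) → i = j) ∧
    (∀ i, ω ∈ percolatesVia (withinGraph ⊤ (↑K : Set (LatticeModels.Site d))ᶜ) (w i))}

/-- Every finite set of sites lies in some box `Λ_n`. [folklore] -/
theorem exists_finset_subset_box (S : Finset (LatticeModels.Site d)) : ∃ n : ℕ, S ⊆ LatticeModels.box d n := by
  classical
  have hcov : ∀ v : LatticeModels.Site d, ∃ n, v ∈ LatticeModels.box d n := fun v => by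
    have hv : v ∈ ⋃ L : ℕ, ((LatticeModels.box d L : Finset (LatticeModels.Site d)) : Set (LatticeModels.Site d)) := by
      rw [LatticeModels.iUnion_coe_box]; exact Set.mem_univ v
    simpa using hv
  induction S using Finset.induction_on with
  | empty => exact ⟨0, Finset.empty_subset _⟩
  | insert a S ha ih =>
    obtain ⟨n, hn⟩ := ih
    obtain ⟨m, hm⟩ := hcov a
    refine ⟨max n m, Finset.insert_subset_iff.2 ⟨LatticeModels.box_mono d (le_max_right _ _) hm, ?_⟩⟩
    exact hn.trans (LatticeModels.box_mono d (le_max_left _ _))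

/-- `threeBranches` is exhausted by the events `threeBranchesInBox r`. [folklore] -/
theorem threeBranches_subset_iUnion_threeBranchesInBox :
    threeBranches (LatticeModels.Site d) ⊆ ⋃ r : ℕ, threeBranchesInBox (d := d) r := by
  classical
  rintro ω ⟨K, w, hdis, hperc⟩
  -- a box containing `K` and the three witnesses
  obtain ⟨r, hr⟩ := exists_finset_subset_box (d := d) (K ∪ Finset.univ.image w)
  refine Set.mem_iUnion.2 ⟨r, K, w, fun x hx => hr (Finset.mem_union_left _ hx), fun i => ?_, hdis, hperc⟩
  exact hr (Finset.mem_union_right _ (Finset.mem_image_of_mem w (Finset.mem_univ i)))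

/-- `threeBranchesInBox r` is measurable. [folklore] -/
theorem measurableSet_threeBranchesInBox (r : ℕ) : MeasurableSet (threeBranchesInBox (d := d) r) := by
  classical
  have heq : threeBranchesInBox (d := d) r = ⋃ K : Finset (LatticeModels.Site d), ⋃ w : Fin 3 → LatticeModels.Site d,
      ({_ω | K ⊆ LatticeModels.box d r} ∩ {_ω | ∀ i, w i ∈ LatticeModels.box d r} ∩
      ((⋂ i, ⋂ j, {_ω | i = j} ∪ (openConnVia (withinGraph ⊤ (↑K : Set (LatticeModels.Site d))ᶜ) (w i) (w j))ᶜ) ∩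
        (⋂ i, percolatesVia (withinGraph ⊤ (↑K : Set (LatticeModels.Site d))ᶜ) (w i)))) := by
    ext ω
    simp only [threeBranchesInBox, Set.mem_setOf_eq, Set.mem_iUnion, Set.mem_inter_iff, Set.mem_iInter,
      Set.mem_union, Set.mem_compl_iff]
    constructor
    · rintro ⟨K, w, hK, hw, hdis, hperc⟩
      refine ⟨K, w, ⟨hK, hw⟩, fun i j => ?_, hperc⟩
      by_cases hij : i = j
      · exact Or.inl hij
      · exact Or.inr fun h => hij (hdis i j h)
    · rintro ⟨K, w, ⟨hK, hw⟩, hdis, hperc⟩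
      refine ⟨K, w, hK, hw, fun i j h => ?_, hperc⟩
      rcases hdis i j with hij | hij
      · exact hij
      · exact absurd h hij
  rw [heq]
  exact MeasurableSet.iUnion fun K => MeasurableSet.iUnion fun w =>
    ((MeasurableSet.const _).inter (MeasurableSet.const _)).inter
    ((MeasurableSet.iInter fun i => MeasurableSet.iInter fun j => (MeasurableSet.const _).union
      (measurableSet_openConnVia _ (w i) (w j)).compl).inter
    (MeasurableSet.iInter fun i => measurableSet_percolatesVia _ (w i)))

/-- **Three infinite branches are almost surely absent** — for a probability measure on bond
configurations of `ℤ^d`, `d ≥ 1`, carried by nearest-neighbour configurations, translation invariant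
and box insertion tolerant, `μ(threeBranches) = 0`: almost surely no finite set of vertices has
three infinite branches; in particular the infinite open cluster, when unique, has at most two ends.
This is the "number of ends at most 2" half of Raoufi 2020, Thm. 3 (stated there for the
infinite-volume random currents of an amenable graph, "proved using a Burton–Keane type argument"),
here for every such `μ` on `ℤ^d`: if `μ(threeBranches) > 0`, some `threeBranchesInBox r` has
positive probability; opening `Λ_r` turns it into the cut-ball event `T_r(0)`
(`openEdges_mem_cutBall_of_threeBranches`), which would then have positive probability by insertion
tolerance — but cut-balls are null (`measureReal_cutBall_eq_zero_of_invariant`). [cite: Raoufi2020, Thm. 3] [cite: BollobasRiordan2006, Ch. 5, proof of Thm. 4 (pp. 107–109)] -/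
theorem measure_threeBranches_eq_zero_of_invariant (hd : 1 ≤ d)
    (μ : Measure (BondConfig (LatticeModels.Site d))) [IsProbabilityMeasure μ]
    (hS : ∀ᵐ ω ∂μ, ω ⊆ (LatticeModels.zdGraph d).edgeSet)
    (hT : ∀ v : LatticeModels.Site d, MeasurePreserving (BondConfig.relabel (sym2Equiv (LatticeModels.Site.shift v))) μ μ)
    (hI : ∀ n : ℕ, ∃ c : ℝ, 0 < c ∧ ∀ E : Set (BondConfig (LatticeModels.Site d)), MeasurableSet E →
      c * μ.real (openEdges ↑(LatticeModels.edgesIn (LatticeModels.zdGraph d) (LatticeModels.box d n)) ⁻¹' E) ≤ μ.real E) :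
    μ (threeBranches (LatticeModels.Site d)) = 0 := by
  classical
  refine measure_mono_null threeBranches_subset_iUnion_threeBranchesInBox
    ((measure_iUnion_null_iff).2 fun r => ?_)
  -- `μ(threeBranchesInBox r) = 0`: opening `Λ_r` maps it (a.s.) into the null cut-ball event
  set A : Set (BondConfig (LatticeModels.Site d)) :=
    threeBranchesInBox r ∩ {ω | ω ⊆ (LatticeModels.zdGraph d).edgeSet} with hA_def
  have hAE : μ {ω : BondConfig (LatticeModels.Site d) | ω ⊆ (LatticeModels.zdGraph d).edgeSet}ᶜ = 0 := by
    rw [Set.compl_setOf]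
    exact ae_iff.1 hS
  have hAT : ∀ ω ∈ A, openEdges ↑(LatticeModels.edgesIn (LatticeModels.zdGraph d) (LatticeModels.box d r)) ω ∈
      cutBall (0 : LatticeModels.Site d) r := by
    rintro ω ⟨⟨K, w, hK, hw, hdis, hperc⟩, hωG⟩
    exact openEdges_mem_cutBall_of_threeBranches hωG hdis hperc hK hw
  obtain ⟨c, hc, hcE⟩ := hI r
  have h1 : μ.real A ≤ μ.real (openEdges ↑(LatticeModels.edgesIn (LatticeModels.zdGraph d) (LatticeModels.box d r)) ⁻¹'
      cutBall (0 : LatticeModels.Site d) r) :=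
    measureReal_mono fun ω hω => hAT ω hω
  have h2 := hcE _ (measurableSet_cutBall 0 r)
  rw [measureReal_cutBall_eq_zero_of_invariant hd μ hS hT r] at h2
  have hA0 : μ.real A = 0 := by
    have : c * μ.real A ≤ 0 := (mul_le_mul_of_nonneg_left h1 hc.le).trans h2
    have hA : 0 ≤ μ.real A := measureReal_nonneg
    nlinarith
  have hA0' : μ A = 0 := by
    rwa [measureReal_def, ENNReal.toReal_eq_zero_iff, or_iff_left (measure_ne_top _ _)] at hA0
  rw [hA_def, measure_inter_conull hAE] at hA0'
  exact hA0'

/-- **Packaged for the tree's `IsInsertionTolerantErgodic` laws** (translation-invariant, ergodic,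
insertion-tolerant lattice measures, `UniquenessInsertionTolerant.lean`; ergodicity is not used):
three infinite branches are almost surely absent. [cite: Raoufi2020, Thm. 3] -/
theorem IsInsertionTolerantErgodic.threeBranches_eq_zero (hd : 1 ≤ d)
    {μ : Measure (BondConfig (LatticeModels.Site d))} [IsProbabilityMeasure μ]
    (h : IsInsertionTolerantErgodic μ) : μ (threeBranches (LatticeModels.Site d)) = 0 :=
  measure_threeBranches_eq_zero_of_invariant hd μ h.ae_subset_edgeSet
    (measurePreserving_relabel_shift_of_forall μ h.measure_preimage_shift)
    fun n => by
      obtain ⟨c, hc, hcE⟩ := h.insertion_tolerant n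
      exact ⟨c, hc, fun E hE => hcE hE⟩

end Invariant

end Literature.Probability.Percolation
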